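import Literature.AlgebraicGeometry.Morphisms.FiniteFlatResiduePointLiftsToSection
import HarnessLib

/-!
# Crux `HLiu418` — P6 sub-line **F0-P6b ConnectedEtale**, stub (b1d) `stub_b1d_reductionSurjective` PAID

Cell `pub/hodgecm-mathlib`, P6 «MOD programme», HEART input (b1-iii) (LEAD M-1a), organ sub-line
`Cruxes/HLiu418/Lines/F0_P6b_ConnectedEtale.lean` ED. 1 (F0P6b-plan (g0), tree sha16 `8210ab19d71568b2`, commit 8dd49ff07d8f), registered-to-be stub
`stub_b1d_reductionSurjective` (§3′, :124).  This file proves THE TEXT of that stub token for token (same binders, universe 0; nothing imports a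
`Cruxes/…/Lines` module) as `stub_b1d_reductionSurjective_holds`, so that the desk folds `stub_b1d_reductionSurjective := …_holds` BY NAME at
the next edition.  The proof is the ★ Literature organ `Literature.AlgebraicGeometry.Morphisms.exists_section_residue_comp_eq`
(`Morphisms/FiniteFlatResiduePointLiftsToSection.lean`, scheme shell) over `ValuationSubring.exists_algHom_residue_comp_eq`
(`RingTheory/Valuation/IntegralPointOfPrescribedSpecialisation.lean`, the algebra: finite flat over the valuation ring of an algebraically closed
field ⇒ free ([StacksProject] Tag 00NZ); the corner of the given `κ(V)`-point is local, finite free, non-zero ([StacksProject] Tag 04GG), so it has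
an `Ω`-point, which is integral, hence a `V`-point with the prescribed specialisation — [SerreTate1968] §1 Lemma 1's mechanism).  Seat F0P6-p11 (g0)
(RE-DEAL 13:29:45Z).  HC_CM is proved only modulo the printed citations until rung 0 closes; nothing here is about HC — it discharges one stub of
an organ sub-line of the MOD programme.

## References
* [SerreTate1968] J.-P. Serre, J. Tate, *Good reduction of abelian varieties*, Ann. of Math. 88 (1968), §1 Lemma 1.
* [Tate1997FiniteFlatGroupSchemes] J. Tate, *Finite flat group schemes*, in: Modular Forms and Fermat's Last Theorem (1997), (3.7).
* [StacksProject] The Stacks Project, Tags 04GG, 00NZ, 01I1.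
-/

set_option linter.dupNamespace false
set_option autoImplicit false

noncomputable section

namespace Summit.HodgeConjecture.HodgeConjecture.Cruxes.HLiu418.F0P6bConnectedEtaleStubB1d

open CategoryTheory AlgebraicGeometry MonoidalCategory IsLocalRing

/-- **(b1d) PAID — over the valuation ring `V` of an algebraically closed field, every `κ(V)`-point of a finite flat `G → Spec V` is the
reduction of a section** (the text of `stub_b1d_reductionSurjective` of `Lines/F0_P6b_ConnectedEtale.lean` ED. 1, verbatim; proof = ★
`Literature.AlgebraicGeometry.Morphisms.exists_section_residue_comp_eq`).  FALSE without flatness and FALSE over a DVR with non-closed fraction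
field (the line card's witnesses), whence the binders. [cite: SerreTate1968, §1 Lemma 1] [cite: Tate1997FiniteFlatGroupSchemes, (3.7)] -/
theorem stub_b1d_reductionSurjective_holds :
    ∀ (Ω : Type) [Field Ω] [IsAlgClosed Ω] (V : ValuationSubring Ω) (G : Over (Spec (.of V))),
      IsFinite G.hom → Flat G.hom →
        ∀ t₀ : Spec (.of (ResidueField V)) ⟶ G.left, t₀ ≫ G.hom = Spec.map (CommRingCat.ofHom (residue V)) →
          ∃ s : 𝟙_ (Over (Spec (.of V))) ⟶ G, Spec.map (CommRingCat.ofHom (residue V)) ≫ s.left = t₀ := by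
  intro Ω _ _ V G hfin hfl t₀ ht₀
  haveI := hfin
  haveI := hfl
  exact Literature.AlgebraicGeometry.Morphisms.exists_section_residue_comp_eq V G t₀ ht₀

end Summit.HodgeConjecture.HodgeConjecture.Cruxes.HLiu418.F0P6bConnectedEtaleStubB1d

end
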